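import Summits.Parity.GeneralizedHardyLittlewood.Theorems.PrimeLevelFamEdgeMomentsBeyondDiagonalLayersFormReductionZero
import Summits.Parity.GeneralizedHardyLittlewood.Theorems.PrimeLevelFamEdgeMomentsBeyondDiagonalLayersPascadiBridge
import HarnessLib

/-!
# Route `PrimeLevelFamEdge`, crux K_A `MomentsBeyondDiagonal` (stmt-Parity-20007), line «petersson_layers» v4:
# Pascadi's bracket on a sharp class in GENERIC variables (assembly step E5b, first reduction)

The closed-form per-class bounds of `…LayersClassBound(All)` carry `bracket71(σ₁'Z₁Z₂, σ₂'V; qr/g, r/g, r/g)^{1/6}` with the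
integer class lengths `Z₁Z₂ = (M/d₁/s₁)(M/d₂/s₂)`, `V = Y/(d₁t₁d₂t₂)`, `σ₁' = s₁t₁/g`, `σ₂' = s₂t₂/g`.  Here the bracket is bounded
by the same expression in real «generic» variables, in the shape the exponent bookkeeping sums (census CENSUS-leafhand2-g2, §Pencil):
* `bracket71_nonneg`, `bracket71_mono` (monotone in the two lengths);
* `cast_dilatedMollifier_le` (`σ₁'Z₁Z₂ ≤ t₁x^{2Δ'}/(g d₁d₂s₂)`), `cast_dilatedAFE_le` (`σ₂'V ≤ s₂Y/(g d₁d₂t₁)`);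
* **`bracket71_class_le`**:
  `bracket71(σ₁'Z₁Z₂, σ₂'V; qr/g, r/g, r/g) ≤ r t₁² x^{6Δ'} Y/(g²(d₁d₂)⁴s₂²(qr)³) + r t₁² x^{4Δ'}/(g(d₁d₂)²s₂²(qr)²) + g/r`
  (`x = q̂`, `g ∣ s₁t₁`, `g ∣ r`).
Remaining (census E5b): evaluate the three terms as powers of `q̂` on the band and sum over classes and blocks; NOT done here.
Proof only (def-free helper); K_A NOT proved; nothing about Landau–Siegel zeros.
-/

noncomputable section

open scoped Real Nat
open Complex Finset Polynomial MeasureTheory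
open Literature.NumberTheory.LFunctions

namespace Summit.Parity.GeneralizedHardyLittlewood.Theorems.MomentsBeyondDiagonal.Layers

open Summit.Parity.GeneralizedHardyLittlewood.Theorems.PrimeLevelFamEdgeIdeaDeltas.PeterssonLayers

/-- Pascadi's bracket is non-negative for non-negative data. [cite: Pascadi2025, Thm. 7.1 (right-hand side)] -/
theorem bracket71_nonneg {M N c d f : ℝ} (hM : 0 ≤ M) (hN : 0 ≤ N) (hc : 0 ≤ c) (hd : 0 ≤ d) (hf : 0 ≤ f) :
    0 ≤ Pascadi2025.bracket71 M N c d f := by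
  unfold Pascadi2025.bracket71; positivity

/-- Pascadi's bracket is monotone in the two lengths. [cite: Pascadi2025, Thm. 7.1 (right-hand side)] -/
theorem bracket71_mono {M M' N N' c d f : ℝ} (hM : 0 ≤ M) (hMM : M ≤ M') (hN : 0 ≤ N) (hNN : N ≤ N') (hc : 0 ≤ c)
    (hd : 0 ≤ d) (hf : 0 ≤ f) :
    Pascadi2025.bracket71 M N c d f ≤ Pascadi2025.bracket71 M' N' c d f := by
  unfold Pascadi2025.bracket71
  have hM' : 0 ≤ M' := hM.trans hMM
  have h3 : M ^ 3 ≤ M' ^ 3 := pow_le_pow_left₀ hM hMM 3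
  have h2 : M ^ 2 ≤ M' ^ 2 := pow_le_pow_left₀ hM hMM 2
  gcongr

/-- A two-step natural floor division is at most the real quotient: `((X/a/b : ℕ) : ℝ) ≤ X/(ab)` (Mathlib's convention `x/0 = 0` makes this unconditional). [folklore] -/
theorem cast_div_div_le (X a b : ℕ) : ((X / a / b : ℕ) : ℝ) ≤ (X : ℝ) / ((a : ℝ) * b) := by
  rw [Nat.div_div_eq_div_mul]
  have h := Nat.cast_div_le (m := X) (n := a * b) (α := ℝ)
  push_cast at h
  exact h

/-- **The dilated mollifier length of a class**: `((s₁t₁/g)·((M/d₁/s₁)(M/d₂/s₂)) : ℝ) ≤ t₁ x^{2Δ'}/(g d₁d₂s₂)`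
(`M = ⌊x^{Δ'}⌋`, `x > 0`, `g ∣ s₁t₁`, all of `dᵢ, sᵢ, g ≥ 1`). [folklore] -/
theorem cast_dilatedMollifier_le {x Δ' : ℝ} (hx : 0 < x) {d₁ d₂ s₁ s₂ t₁ g : ℕ} (hd₁ : 1 ≤ d₁) (hd₂ : 1 ≤ d₂)
    (hs₁ : 1 ≤ s₁) (hs₂ : 1 ≤ s₂) (hg0 : 1 ≤ g) (hg : g ∣ s₁ * t₁) :
    ((s₁ * t₁ / g * ((⌊x ^ Δ'⌋₊ / d₁ / s₁) * (⌊x ^ Δ'⌋₊ / d₂ / s₂)) : ℕ) : ℝ) ≤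
      (t₁ : ℝ) * x ^ (2 * Δ') / ((g : ℝ) * d₁ * d₂ * s₂) := by
  have hg0' : (g : ℝ) ≠ 0 := by exact_mod_cast (by omega : g ≠ 0)
  have hMx : ((⌊x ^ Δ'⌋₊ : ℕ) : ℝ) ≤ x ^ Δ' := Nat.floor_le (Real.rpow_nonneg hx.le _)
  have hZ₁ : ((⌊x ^ Δ'⌋₊ / d₁ / s₁ : ℕ) : ℝ) ≤ x ^ Δ' / ((d₁ : ℝ) * s₁) :=
    (cast_div_div_le _ d₁ s₁).trans (div_le_div_of_nonneg_right hMx (by positivity))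
  have hZ₂ : ((⌊x ^ Δ'⌋₊ / d₂ / s₂ : ℕ) : ℝ) ≤ x ^ Δ' / ((d₂ : ℝ) * s₂) :=
    (cast_div_div_le _ d₂ s₂).trans (div_le_div_of_nonneg_right hMx (by positivity))
  have hσ : ((s₁ * t₁ / g : ℕ) : ℝ) = (s₁ : ℝ) * t₁ / g := by
    rw [Nat.cast_div hg hg0']; push_cast; ring
  push_cast
  rw [hσ]
  calc (s₁ : ℝ) * t₁ / g * (((⌊x ^ Δ'⌋₊ / d₁ / s₁ : ℕ) : ℝ) * ((⌊x ^ Δ'⌋₊ / d₂ / s₂ : ℕ) : ℝ))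
      ≤ (s₁ : ℝ) * t₁ / g * ((x ^ Δ' / ((d₁ : ℝ) * s₁)) * (x ^ Δ' / ((d₂ : ℝ) * s₂))) :=
        mul_le_mul_of_nonneg_left (mul_le_mul hZ₁ hZ₂ (Nat.cast_nonneg _) (by positivity)) (by positivity)
    _ = (t₁ : ℝ) * x ^ (2 * Δ') / ((g : ℝ) * d₁ * d₂ * s₂) := by
        have hs₁0 : (s₁ : ℝ) ≠ 0 := by exact_mod_cast (by omega : s₁ ≠ 0)
        rw [show (2 : ℝ) * Δ' = Δ' + Δ' by ring, Real.rpow_add hx]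
        field_simp

/-- **The dilated AFE length of a class**: `((s₂t₂/g)·(Y/(d₁t₁·d₂t₂)) : ℝ) ≤ s₂ Y/(g d₁d₂t₁)` (`g ∣ s₂t₂`; all `≥ 1`). [folklore] -/
theorem cast_dilatedAFE_le {Y d₁ d₂ t₁ t₂ s₂ g : ℕ} (hd₁ : 1 ≤ d₁) (hd₂ : 1 ≤ d₂) (ht₁ : 1 ≤ t₁) (ht₂ : 1 ≤ t₂)
    (hg0 : 1 ≤ g) (hg : g ∣ s₂ * t₂) :
    ((s₂ * t₂ / g * (Y / (d₁ * t₁ * (d₂ * t₂))) : ℕ) : ℝ) ≤ (s₂ : ℝ) * Y / ((g : ℝ) * d₁ * d₂ * t₁) := by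
  have hg0' : (g : ℝ) ≠ 0 := by exact_mod_cast (by omega : g ≠ 0)
  have ht₂0 : (t₂ : ℝ) ≠ 0 := by exact_mod_cast (by omega : t₂ ≠ 0)
  have hσ : ((s₂ * t₂ / g : ℕ) : ℝ) = (s₂ : ℝ) * t₂ / g := by
    rw [Nat.cast_div hg hg0']; push_cast; ring
  have hV : ((Y / (d₁ * t₁ * (d₂ * t₂)) : ℕ) : ℝ) ≤ (Y : ℝ) / ((d₁ : ℝ) * t₁ * (d₂ * t₂)) := by
    have h := Nat.cast_div_le (m := Y) (n := d₁ * t₁ * (d₂ * t₂)) (α := ℝ)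
    push_cast at h
    exact h
  push_cast
  rw [hσ]
  calc (s₂ : ℝ) * t₂ / g * (((Y / (d₁ * t₁ * (d₂ * t₂))) : ℕ) : ℝ)
      ≤ (s₂ : ℝ) * t₂ / g * ((Y : ℝ) / ((d₁ : ℝ) * t₁ * (d₂ * t₂))) := mul_le_mul_of_nonneg_left hV (by positivity)
    _ = (s₂ : ℝ) * Y / ((g : ℝ) * d₁ * d₂ * t₁) := by
        field_simp

/-- **Pascadi's bracket on a class in generic variables** (`x = q̂ > 0`; `g ∣ s₁t₁`, `g ∣ s₂t₂`, `g ∣ r`, `g ∣ qr`; all of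
`q, r, dᵢ, sᵢ, tᵢ, g ≥ 1`):
`bracket71(σ₁'Z₁Z₂, σ₂'V; qr/g, r/g, r/g) ≤ r t₁² x^{6Δ'} Y/(g²(d₁d₂)⁴ s₂² (qr)³) + r t₁² x^{4Δ'}/(g (d₁d₂)² s₂² (qr)²) + g/r`.
[cite: Pascadi2025, Thm. 7.1 (right-hand side)] -/
theorem bracket71_class_le {x Δ' : ℝ} (hx : 0 < x) {q r Y d₁ d₂ s₁ s₂ t₁ t₂ g : ℕ} (hq : 1 ≤ q) (hr : 1 ≤ r)
    (hd₁ : 1 ≤ d₁) (hd₂ : 1 ≤ d₂) (hs₁ : 1 ≤ s₁) (hs₂ : 1 ≤ s₂) (ht₁ : 1 ≤ t₁) (ht₂ : 1 ≤ t₂) (hg0 : 1 ≤ g)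
    (hg₁ : g ∣ s₁ * t₁) (hg₂ : g ∣ s₂ * t₂) (hgr : g ∣ r) :
    Pascadi2025.bracket71
        ((s₁ * t₁ / g * ((⌊x ^ Δ'⌋₊ / d₁ / s₁) * (⌊x ^ Δ'⌋₊ / d₂ / s₂)) : ℕ) : ℝ)
        ((s₂ * t₂ / g * (Y / (d₁ * t₁ * (d₂ * t₂))) : ℕ) : ℝ)
        ((q * r / g : ℕ) : ℝ) ((r / g : ℕ) : ℝ) ((r / g : ℕ) : ℝ) ≤
      (r : ℝ) * (t₁ : ℝ) ^ 2 * x ^ (6 * Δ') * Y / ((g : ℝ) ^ 2 * ((d₁ : ℝ) * d₂) ^ 4 * (s₂ : ℝ) ^ 2 * ((q : ℝ) * r) ^ 3) +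
        (r : ℝ) * (t₁ : ℝ) ^ 2 * x ^ (4 * Δ') / ((g : ℝ) * ((d₁ : ℝ) * d₂) ^ 2 * (s₂ : ℝ) ^ 2 * ((q : ℝ) * r) ^ 2) +
        (g : ℝ) / r := by
  have hg0' : (g : ℝ) ≠ 0 := by exact_mod_cast (by omega : g ≠ 0)
  have hgpos : (0 : ℝ) < g := by exact_mod_cast hg0
  have hqr : g ∣ q * r := hgr.mul_left q
  have hc : ((q * r / g : ℕ) : ℝ) = (q : ℝ) * r / g := by rw [Nat.cast_div hqr hg0']; push_cast; ring
  have hr' : ((r / g : ℕ) : ℝ) = (r : ℝ) / g := by rw [Nat.cast_div hgr hg0']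
  have hM := cast_dilatedMollifier_le (x := x) (Δ' := Δ') hx hd₁ hd₂ hs₁ hs₂ hg0 hg₁
  have hN := cast_dilatedAFE_le (Y := Y) hd₁ hd₂ ht₁ ht₂ hg0 hg₂
  rw [hc, hr']
  refine (bracket71_mono (Nat.cast_nonneg _) hM (Nat.cast_nonneg _) hN (by positivity) (by positivity)
    (by positivity)).trans (le_of_eq ?_)
  unfold Pascadi2025.bracket71
  have hq0 : (q : ℝ) ≠ 0 := by exact_mod_cast (by omega : q ≠ 0)
  have hr0 : (r : ℝ) ≠ 0 := by exact_mod_cast (by omega : r ≠ 0)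
  have hd₁0 : (d₁ : ℝ) ≠ 0 := by exact_mod_cast (by omega : d₁ ≠ 0)
  have hd₂0 : (d₂ : ℝ) ≠ 0 := by exact_mod_cast (by omega : d₂ ≠ 0)
  have hs₂0 : (s₂ : ℝ) ≠ 0 := by exact_mod_cast (by omega : s₂ ≠ 0)
  have ht₁0 : (t₁ : ℝ) ≠ 0 := by exact_mod_cast (by omega : t₁ ≠ 0)
  have e6 : x ^ (6 * Δ') = (x ^ (2 * Δ')) ^ (3 : ℕ) := by
    rw [← Real.rpow_natCast, ← Real.rpow_mul hx.le]; push_cast; ring_nf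
  have e4 : x ^ (4 * Δ') = (x ^ (2 * Δ')) ^ (2 : ℕ) := by
    rw [← Real.rpow_natCast, ← Real.rpow_mul hx.le]; push_cast; ring_nf
  rw [e6, e4]
  field_simp

end Summit.Parity.GeneralizedHardyLittlewood.Theorems.MomentsBeyondDiagonal.Layers

end
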